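import Literature.Algebra.Homology.OrderedCechSystemCupHomology
import Literature.Algebra.Homology.OrderedCechSystemCupAssoc
import Literature.Algebra.Homology.OrderedCechSystemCupAlgebra

/-!
# The cup product on ordered Čech cohomology CLASSES: curried `ℕ`-graded form, associativity, units, bounded grading

For a natural pairing `β : M × N → P` of systems of `A`-modules on the finite subsets of a linearly ordered index
type, ★ `OrderedCechSystemCupHomology` descends the ordered Čech cup product to cohomology through ★
`bilinearHomologyMap`.  This file packages the descended product in the CURRIED, `ℕ`-GRADED shape
`cupH β … a b n (h : a + b = n) : Ȟᵃ(M) →ₗ[A] Ȟᵇ(N) →ₗ[A] Ȟⁿ(P)` consumed by the bialgebra assembly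
★ `Algebra/Bialgebra/DegreeTwoCupSurjectiveOfKunneth` (pieces `HA n = Ȟⁿ`, products with target degree as data),
and proves ON CLASSES: the defining formula on cocycles (`cupH_π`), associativity (`cupH_assoc`, from ★
`cup_assoc`), two-sided units (`cupH_unit_left∕right`, from ★ `unit_cup`∕`cup_unit`), and the vanishing of `Ȟⁿ`
for `n ≥ #ι` (`eq_zero_of_card_le`, bounded grading). [cite: Godement1958, II §6.6]
[cite: GortzWedhorn2023, (21.29)]  One definition (`cupH`); everything else proved; Mathlib + ★ files only.
-/

namespace Literature.Algebra.Homology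

open CategoryTheory CategoryTheory.Limits CategoryTheory.MonoidalCategory HomologicalComplex TensorProduct

universe u

namespace OrderedCech

variable {ι : Type} [LinearOrder ι] {A : Type u} [CommRing A] {M N P : Finset ι ⥤ ModuleCat.{u} A}
  (β : ∀ s : Finset ι, M.obj s →ₗ[A] N.obj s →ₗ[A] P.obj s)

set_option backward.isDefEq.respectTransparency false

noncomputable section

/-- **The cup product on ordered Čech cohomology classes, curried and `ℕ`-graded**:
`cupH β hβ a b n h : Ȟᵃ(M) →ₗ[A] Ȟᵇ(N) →ₗ[A] Ȟⁿ(P)` for `a + b = n`, the curried form of the descended pairing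
`bilinearHomologyMap` of the cochain cup product `cup β a b n`. [cite: Godement1958, II §6.6]
[cite: GortzWedhorn2023, (21.29)] -/
def cupH (hβ : IsNaturalPairing β) (a b n : ℕ) (h : a + b = n) :
    (sysComplex M).homology (a : ℤ) →ₗ[A] (sysComplex N).homology (b : ℤ) →ₗ[A] (sysComplex P).homology (n : ℤ) :=
  TensorProduct.curry
    (bilinearHomologyMap (sysComplex M) (sysComplex N) (sysComplex P) (p₀ := (a : ℤ) - 1) (q₀ := (b : ℤ) - 1)
      (n₀ := (n : ℤ) - 1) (by omega) (by omega) (by omega)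
      (ModuleCat.ofHom (lift (cup β a b n)) : (sysComplex M).X a ⊗ (sysComplex N).X b ⟶ (sysComplex P).X n)
      (cupPairing_cycles hβ (by omega) (by omega) (by omega)) _
      (cupPairing_boundary_left hβ (by omega) (by omega) (by omega) (by omega)) _
      (cupPairing_boundary_right hβ (by omega) (by omega) (by omega) (by omega))).hom

/-- **The cup product of two classes of cocycles is the class of the cup product of the cocycles**:
`cupH [z] [w] = [z ∪ w]`, where `z ∪ w` is the cycle `cyclesPairingToCycles (z ⊗ w)` with underlying cochain
`cup β a b n z w`. [cite: Godement1958, II §6.6] -/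
theorem cupH_π (hβ : IsNaturalPairing β) (a b n : ℕ) (h : a + b = n) (z : (sysComplex M).cycles (a : ℤ))
    (w : (sysComplex N).cycles (b : ℤ)) :
    cupH β hβ a b n h (((sysComplex M).homologyπ a).hom z) (((sysComplex N).homologyπ b).hom w) =
      ((sysComplex P).homologyπ n).hom
        ((cyclesPairingToCycles (sysComplex M) (sysComplex N) (sysComplex P)
          (ModuleCat.ofHom (lift (cup β a b n)) : (sysComplex M).X a ⊗ (sysComplex N).X b ⟶ (sysComplex P).X n)
          (cupPairing_cycles hβ (by omega) (by omega) (by omega))).hom (z ⊗ₜ w)) := by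
  rw [cupH, TensorProduct.curry_apply]
  exact bilinearHomologyMap_tmul _ _ _ _ _ _ _ _ _ _ _ _ z w

/-- The underlying cochain of the cycle `z ∪ w` is `cup β a b n z w`. [cite: Godement1958, II §6.6] -/
theorem iCycles_cupCycles (hβ : IsNaturalPairing β) (a b n : ℕ) (h : a + b = n) (z : (sysComplex M).cycles (a : ℤ))
    (w : (sysComplex N).cycles (b : ℤ)) :
    ((sysComplex P).iCycles n).hom
      ((cyclesPairingToCycles (sysComplex M) (sysComplex N) (sysComplex P)
        (ModuleCat.ofHom (lift (cup β a b n)) : (sysComplex M).X a ⊗ (sysComplex N).X b ⟶ (sysComplex P).X n)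
        (cupPairing_cycles hβ (by omega) (by omega) (by omega))).hom (z ⊗ₜ w)) =
      cup β a b n (((sysComplex M).iCycles a).hom z) (((sysComplex N).iCycles b).hom w) := by
  have hc := cyclesPairingToCycles_i (sysComplex M) (sysComplex N) (sysComplex P)
    (ModuleCat.ofHom (lift (cup β a b n)) : (sysComplex M).X a ⊗ (sysComplex N).X b ⟶ (sysComplex P).X n)
    (cupPairing_cycles hβ (by omega) (by omega) (by omega))
  have := congrArg (fun f => f.hom (z ⊗ₜ w)) hc
  simp only [ModuleCat.hom_comp, LinearMap.comp_apply] at this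
  rw [this, cyclesPairingι, ModuleCat.hom_comp, LinearMap.comp_apply, ModuleCat.MonoidalCategory.tensorHom_tmul,
    ModuleCat.hom_ofHom]
  exact lift.tmul _ _

/-- Classes are represented by cocycles (`π` is onto). [cite: Godement1958, II §6.6] -/
theorem homologyπ_surjective (K : CochainComplex (ModuleCat.{u} A) ℤ) (i : ℤ) :
    Function.Surjective (K.homologyπ i).hom :=
  (ModuleCat.epi_iff_surjective _).1 inferInstance

/-- Cycles with the same underlying cochain are equal (`ι` is a monomorphism). [cite: Godement1958, II §6.6] -/
theorem cycles_ext (K : CochainComplex (ModuleCat.{u} A) ℤ) (i : ℤ) {z z' : K.cycles i}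
    (h : (K.iCycles i).hom z = (K.iCycles i).hom z') : z = z' :=
  (ModuleCat.mono_iff_injective _).1 inferInstance h

/-! ### Associativity and units on classes -/

variable {Q MN NQ R : Finset ι ⥤ ModuleCat.{u} A}

/-- **Associativity of the cup product on classes**: for natural pairings `α : M × N → MN`, `β' : MN × Q → R`,
`γ : N × Q → NQ`, `δ : M × NQ → R` with `β'(α(x,y),z) = δ(x,γ(y,z))`, and all degrees carried as data,
`(x ∪ y) ∪ z = x ∪ (y ∪ z)` in `Ȟ(R)`. (From ★ `cup_assoc` on cocycles.) [cite: Godement1958, II §6.6] -/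
theorem cupH_assoc {α : ∀ s : Finset ι, M.obj s →ₗ[A] N.obj s →ₗ[A] MN.obj s}
    {β' : ∀ s : Finset ι, MN.obj s →ₗ[A] Q.obj s →ₗ[A] R.obj s}
    {γ : ∀ s : Finset ι, N.obj s →ₗ[A] Q.obj s →ₗ[A] NQ.obj s}
    {δ : ∀ s : Finset ι, M.obj s →ₗ[A] NQ.obj s →ₗ[A] R.obj s}
    (hα : IsNaturalPairing α) (hβ' : IsNaturalPairing β') (hγ : IsNaturalPairing γ) (hδ : IsNaturalPairing δ)
    (compat : ∀ (s : Finset ι) (x : M.obj s) (y : N.obj s) (z : Q.obj s), β' s (α s x y) z = δ s x (γ s y z))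
    (a b c ab bc n : ℕ) (hab : a + b = ab) (hbc : b + c = bc) (h : ab + c = n)
    (x : (sysComplex M).homology (a : ℤ)) (y : (sysComplex N).homology (b : ℤ)) (z : (sysComplex Q).homology (c : ℤ)) :
    cupH β' hβ' ab c n h (cupH α hα a b ab hab x y) z = cupH δ hδ a bc n (by omega) x (cupH γ hγ b c bc hbc y z) := by
  obtain ⟨zx, rfl⟩ := homologyπ_surjective (sysComplex M) a x
  obtain ⟨zy, rfl⟩ := homologyπ_surjective (sysComplex N) b y
  obtain ⟨zz, rfl⟩ := homologyπ_surjective (sysComplex Q) c z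
  rw [cupH_π α hα a b ab hab, cupH_π β' hβ' ab c n h, cupH_π γ hγ b c bc hbc, cupH_π δ hδ a bc n (by omega)]
  refine congrArg ((sysComplex R).homologyπ (n : ℤ)).hom (cycles_ext _ _ ?_)
  rw [iCycles_cupCycles β' hβ' ab c n h, iCycles_cupCycles α hα a b ab hab, iCycles_cupCycles δ hδ a bc n (by omega),
    iCycles_cupCycles γ hγ b c bc hbc]
  exact cup_assoc hα hγ compat (by exact_mod_cast hab) (by exact_mod_cast hbc) _ _ _

/-- **Left unit on classes**: for a pairing `β : M × N → N` with `β_s(u_s, y) = y` for a compatible family of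
unit sections `u`, and a `0`-cycle `e` whose cochain is `σ ↦ u_σ`, `[e] ∪ y = y`. (From ★ `unit_cup`.)
[cite: Godement1958, II §6.6] -/
theorem cupH_unit_left {β₁ : ∀ s : Finset ι, M.obj s →ₗ[A] N.obj s →ₗ[A] N.obj s} (hβ₁ : IsNaturalPairing β₁)
    (u : ∀ s : Finset ι, M.obj s) (hu : ∀ ⦃s t : Finset ι⦄ (h : s ⊆ t), (M.map (homOfLE h)).hom (u s) = u t)
    (hβu : ∀ (s : Finset ι) (y : N.obj s), β₁ s (u s) y = y) (e : (sysComplex M).cycles ((0 : ℕ) : ℤ))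
    (he : ((sysComplex M).iCycles _).hom e = (fun σ => u σ.1 : SysCochain M ((0 : ℕ) : ℤ))) (b : ℕ)
    (y : (sysComplex N).homology (b : ℤ)) :
    cupH β₁ hβ₁ 0 b b (by omega) (((sysComplex M).homologyπ _).hom e) y = y := by
  obtain ⟨w, rfl⟩ := homologyπ_surjective (sysComplex N) b y
  rw [cupH_π β₁ hβ₁ 0 b b (by omega)]
  refine congrArg ((sysComplex N).homologyπ (b : ℤ)).hom (cycles_ext _ _ ?_)
  rw [iCycles_cupCycles β₁ hβ₁ 0 b b (by omega), he]
  exact unit_cup u hu hβu _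

/-- **Right unit on classes**: for a pairing `β : N × M → N` with `β_s(y, u_s) = y` and a `0`-cycle `e` with cochain
`σ ↦ u_σ`, `y ∪ [e] = y`. (From ★ `cup_unit`.) [cite: Godement1958, II §6.6] -/
theorem cupH_unit_right {β₂ : ∀ s : Finset ι, N.obj s →ₗ[A] M.obj s →ₗ[A] N.obj s} (hβ₂ : IsNaturalPairing β₂)
    (u : ∀ s : Finset ι, M.obj s) (hu : ∀ ⦃s t : Finset ι⦄ (h : s ⊆ t), (M.map (homOfLE h)).hom (u s) = u t)
    (hβu : ∀ (s : Finset ι) (y : N.obj s), β₂ s y (u s) = y) (e : (sysComplex M).cycles ((0 : ℕ) : ℤ))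
    (he : ((sysComplex M).iCycles _).hom e = (fun σ => u σ.1 : SysCochain M ((0 : ℕ) : ℤ))) (a : ℕ)
    (y : (sysComplex N).homology (a : ℤ)) :
    cupH β₂ hβ₂ a 0 a (by omega) y (((sysComplex M).homologyπ _).hom e) = y := by
  obtain ⟨w, rfl⟩ := homologyπ_surjective (sysComplex N) a y
  rw [cupH_π β₂ hβ₂ a 0 a (by omega)]
  refine congrArg ((sysComplex N).homologyπ (a : ℤ)).hom (cycles_ext _ _ ?_)
  rw [iCycles_cupCycles β₂ hβ₂ a 0 a (by omega), he]
  exact cup_unit u hu hβu _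

/-! ### Bounded grading -/

/-- **`Ȟⁿ = 0` for `n ≥ #ι`** (the ordered complex of a finite index type stops in degree `#ι - 1`).
[cite: GortzWedhorn2023, (21.29)] -/
theorem eq_zero_of_card_le [Fintype ι] (n : ℕ) (hn : Fintype.card ι ≤ n) (y : (sysComplex M).homology (n : ℤ)) :
    y = 0 := by
  have hX : IsZero ((sysComplex M).X (n : ℤ)) := isZero_sysComplex_X_of_card_le M n (by exact_mod_cast hn)
  have hH : IsZero ((sysComplex M).homology (n : ℤ)) := ShortComplex.isZero_homology_of_isZero_X₂ _ hX
  haveI := ModuleCat.subsingleton_of_isZero hH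
  exact Subsingleton.elim _ _

/-- Bounded grading in the shape consumed by the bialgebra assembly: `∃ N, ∀ n ≥ N, Ȟⁿ = 0`.
[cite: GortzWedhorn2023, (21.29)] -/
theorem exists_bound_homology_eq_zero [Fintype ι] :
    ∃ N : ℕ, ∀ n : ℕ, N ≤ n → ∀ y : (sysComplex M).homology (n : ℤ), y = 0 :=
  ⟨Fintype.card ι, fun n hn y => eq_zero_of_card_le n hn y⟩

end

end OrderedCech

end Literature.Algebra.Homology
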